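import Literature.NumberTheory.EllipticCurves.KuriharaNumberKimShaLength
import HarnessLib

/-!
# Kim 2026, Thm. 1.8 (6) in analytic rank `0`: the UPPER BOUND `length Ш(E/ℚ)[p^∞] ≤ ord_p(L(E,1)/Ω⁺_E)` at ANY reduction type (named fact)

Topic `NumberTheory/EllipticCurves`, sub-directory `Kim2026` (author–year; namespace = path,
`Literature.NumberTheory.EllipticCurves.Kim2026`). ONE named fact (`def … : Prop`, D-0014), weaker
than print, and nothing else. Sibling of the four unit-Kurihara-number facts of
`KuriharaNumberKimShaLength` (`Kim2022_rankZero_padicValRat_sha_of_kuriharaNumber_ne_zero[_of_maninConstant]`,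
…), which render clause (6) of the same theorem as an EQUALITY given a unit Kurihara number; the
present fact is the certificate-free INEQUALITY that clause (6) yields in analytic rank `0` with no
Kurihara number at all. Written for the residual cell `b2b-bsdres` (class X4 = additive `p`, `E[p]`
irreducible; seat additive-p4), whose consumer is
`Summits/BirchSwinnertonDyer/Rank1Residual/Additive/X4RankZeroUpperBound.lean`.

## The printed statements (C.-H. Kim, *The structure of Selmer groups and the Iwasawa main
conjecture for elliptic curves*, Amer. J. Math. 148 (2026), no. 1, 79–129 = arXiv:2203.12159; held
text = arXiv v3/v4, whose Thm. 1.9 is Thm. 1.8 of the journal version, statement byte-identical —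
see the NUMBERING NOTE of `KuriharaNumberKimStructure`)

* §1.4.1 (PDF p. 7): "Let `p ≥ 5` be a prime and `E` an elliptic curve over `ℚ` such that the
  residual representation `ρ̄` is irreducible and the Manin constant is prime to `p`. … the modular
  symbol `[r]⁺` is defined by `2π ∫₀^∞ f(r + iy) dy = [r]⁺ Ω⁺_E + [r]⁻ √-1 Ω⁻_E` where `[r]⁺` and
  `[r]⁻` are rational numbers … the real Néron period `Ω⁺_E` of `E` is taken as the absolute value
  of the integral of an invariant differential of a global minimal Weierstrass model of `E` over
  `E(ℝ)`. … Under our assumptions, we have `[r]⁺ ∈ ℤ_(p)`".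
* §1.4.3 (PDF p. 7): "When `n = 1`, we have `δ̃_1 = [0]⁺ = L(E,1)/Ω⁺_E ∈ ℤ_(p)`."
* §1.4.4 (PDF p. 7): "`ord(δ̃) = min{ν(n) : n ∈ 𝒩_1, δ̃_n ≠ 0}`" (`ν(1) = 0`).
* §1.5.1 (PDF p. 7): "Denote by `∂^{(0)}(δ̃)` the `p`-adic valuation of `δ̃_1` … For `i ∈ ℤ_{>0}`,
  `∂^{(i)}(δ̃) = min{j : δ̃_n ∈ p^j ℤ_p/I_nℤ_p for every n ∈ 𝒩_1 with ν(n) = i}` …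
  `∂^{(∞)}(δ̃) = min{∂^{(i)}(δ̃) : 0 ≤ i}`."
* **Theorem 1.9** (PDF pp. 7–8): "Let `E` be an elliptic curve over `ℚ` and `p ≥ 5` a prime such
  that `ρ̄` is surjective and the Manin constant is prime to `p`. If `ord(δ̃) < ∞`, then … If we
  further assume the finiteness of `Ш(E/ℚ)[p^∞]`, then we have … (6)
  `length_{ℤ_p}(Ш(E/ℚ)[p^∞]) = ∂^{(ord(δ̃))}(δ̃) − ∂^{(∞)}(δ̃)`."
* §1.3.5 (PDF p. 6): "The Manin constant is not divisible by a prime `p ≥ 3` if `E` has semi-stable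
  reduction at `p` [Mazur 1978]. Thus, the Manin constant assumption is needed only when `E` has
  additive reduction at `p`." — Theorem 1.9 carries NO hypothesis on the reduction type at `p`; the
  additive case is treated inside the proof (Prop. 3.2, Lemma 3.10, PDF pp. 15, 17), as recorded in
  the section docstring "The rank-zero clause at ANY prime `p ≥ 5`" of `KuriharaNumberKimShaLength`.

## The fact below (weaker than print)

In analytic rank `0` (`L(E,1) ≠ 0`): `δ̃_1 = L(E,1)/Ω⁺_E ≠ 0`, so `ord(δ̃) = ν(1) = 0 < ∞` (§1.4.3–4)
and Theorem 1.9 applies with `∂^{(ord(δ̃))}(δ̃) = ∂^{(0)}(δ̃) = ord_p(δ̃_1) = ord_p(L(E,1)/Ω⁺_E)`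
(§1.5.1). Every `∂^{(i)}(δ̃)` is a minimum of non-negative integers and `∂^{(∞)}(δ̃)` is their
minimum over `i ≥ 0`, so `0 ≤ ∂^{(∞)}(δ̃) ≤ ∂^{(0)}(δ̃)`; clause (6) therefore gives
`length_{ℤ_p} Ш(E/ℚ)[p^∞] = ord_p(L(E,1)/Ω⁺_E) − ∂^{(∞)}(δ̃) ≤ ord_p(L(E,1)/Ω⁺_E)`, i.e.
`ord_p #Ш(E/ℚ)(p) ≤ ord_p(L(E,1)/Ω⁺_E)` with `L(E,1)/Ω⁺_E = [0]⁺ ∈ ℚ`. This is the statement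
typed below: `L(E,1)/Ω(W)` is a rational `q` with `ord_p #Ш(E/ℚ)(p) ≤ ord_p q`. (The equality
`∂^{(∞)}(δ̃) = ∑_ℓ ord_p c_ℓ` is Kim's CONJECTURE 1.10, PDF p. 8 — open; with it the inequality
would become the `p`-part of BSD in rank `0`. Not typed here.)

NORMALISATIONS, identical to the siblings in `KuriharaNumberKimShaLength` (see there, "The Lean
statement and its normalisation" / "THE MANIN CONSTANT"): Kim's `Ω⁺_E` — the Néron period of the
global minimal model integrated over `E(ℝ)`, components included — is the tree's `W.realPeriodRat`
for the globally minimal `W`; no Kurihara number of the tree (`Ω⁺_f`-normalised) occurs, so no period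
transfer binder is needed; Kim's hypothesis (ii) "the Manin constant is prime to `p`" is carried
EXPLICITLY, exactly as in `Kim2022_rankZero_padicValRat_sha_of_kuriharaNumber_ne_zero_of_maninConstant`,
by a modular parametrisation datum `D : ModularParametrizationData W N` with `p ∤ D.maninConstant`
(needed precisely when `p² ∣ N`, §1.3.5); "the finiteness of `Ш(E/ℚ)[p^∞]`" is rendered by the
stronger binder `Finite W.sha` (weaker fact). Weaker than print in every respect; never stronger.
No `_holds` (size XL: the whole paper — Mazur–Rubin Kolyvagin systems, Kato's Euler system and
explicit reciprocity law). An earlier printed source for the same inequality at an additive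
`p > 7` under extra hypotheses is Kim–Nakamura, J. Number Theory 210 (2020), Thm. 4.2 (2) with
Cor. 2.4 and Thm. 4.5 (`length Sel_str ≤ ∂^{(0)}`); not typed separately.

## References

* C.-H. Kim, Amer. J. Math. 148 (2026) 79–129 = arXiv:2203.12159, §1.3.5, §1.4.1, §1.4.3–1.4.4,
  §1.5.1, Thm. 1.9 (= Thm. 1.8 of the journal version), Conj. 1.10. [Kim2022StructureSelmer]
* C.-H. Kim, K. Nakamura, J. Number Theory 210 (2020) 249–279, Thm. 4.2, Cor. 2.4, Thm. 4.5. [KimNakamura2020]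
* B. Mazur, Invent. Math. 44 (1978), Cor. 4.1. [Mazur1978]
-/

noncomputable section

open scoped MatrixGroups ModularForm Classical

open CongruenceSubgroup Literature.NumberTheory.EllipticCurves.ModularForms

namespace Literature.NumberTheory.EllipticCurves.Kim2026

/-- **Kim's structure theorem, clause (6), analytic rank `0`: the certificate-free upper bound, ANY
reduction type at `p` (additive included)** (C.-H. Kim, Amer. J. Math. 148 (2026) 79–129, Thm. 1.8
= arXiv:2203.12159v4 **Thm. 1.9 (6)**, with §1.4.1, §1.4.3 (`δ̃_1 = [0]⁺ = L(E,1)/Ω⁺_E ∈ ℤ_(p)`),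
§1.4.4 (`ord(δ̃)`), §1.5.1 (`∂^{(0)}(δ̃) = ord_p δ̃_1`, `∂^{(∞)}(δ̃) = min_i ∂^{(i)}(δ̃) ≥ 0`), §1.3.5;
PDF pp. 6–8; see the module docstring for the verbatim statements and the one-line derivation).
Let `W/ℚ` be a globally minimal elliptic curve and `p ≥ 5` a prime — NO hypothesis on the
reduction of `W` at `p` — with `ρ̄_{E,p}` surjective; let `D` be a modular parametrisation datum of
`W` at level `N` whose Manin constant is prime to `p` (Kim's hypothesis, needed exactly when
`p² ∣ N`); assume `L(E,1) ≠ 0` (so `ord(δ̃) = 0`) and `Ш(E/ℚ)` finite. Then clause (6) reads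
`length_{ℤ_p} Ш(E/ℚ)[p^∞] = ord_p(L(E,1)/Ω⁺_E) − ∂^{(∞)}(δ̃) ≤ ord_p(L(E,1)/Ω⁺_E)`: there is
`q ∈ ℚ` with `L(E,1)/Ω(W) = q` and `ord_p #Ш(E/ℚ)(p) ≤ ord_p q`. Weaker than print (inequality
only; `Finite W.sha` for the finiteness of `Ш[p^∞]`), never stronger. No `_holds` (size XL).
[cite: Kim2022StructureSelmer, Thm. 1.9 (6) (PDF p. 8), §1.4.1 and §1.4.3–1.4.4 (PDF p. 7), §1.5.1 (PDF p. 7), §1.3.5 (PDF p. 6)]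
[cite: KimNakamura2020, Thm. 4.2 (2), Cor. 2.4, Thm. 4.5] -/
def rankZero_padicValNat_sha_le_of_maninConstant : Prop :=
  ∀ (W : WeierstrassCurve ℚ) [W.IsElliptic] [W.IsGloballyMinimal] (p : ℕ) [Fact p.Prime],
    5 ≤ p → W.HasSurjectiveModNGaloisRep p →
    W.entireLFunction 1 ≠ 0 → Finite W.sha →
    ∀ {N : ℕ} [NeZero N] (D : ModularParametrizationData W N),
    ¬ (p : ℤ) ∣ D.maninConstant →
    ∃ q : ℚ, W.entireLFunction 1 / (W.realPeriodRat : ℂ) = (q : ℂ) ∧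
      (padicValNat p (Nat.card (AddCommGroup.primaryComponent W.sha p)) : ℤ) ≤ padicValRat p q

end Literature.NumberTheory.EllipticCurves.Kim2026

end
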